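import Summits.NavierStokesRegularity.NavierStokesRegularity.Theses.FilamentSkeletonRss

/-! Tools stubs of line `Sketch` (crux stmt-NavierStokesRegularity-15400): signatures registered by `stub-add`,
each to be landed `--supports stmt-NavierStokesRegularity-15400` in its own Theorems file. -/

noncomputable section

open Set MeasureTheory Filter Topology
open Literature.Analysis.FluidPDE

namespace Summit.NavierStokesRegularity.NavierStokesRegularity.Cruxes.SkeletonEquilibrium.Sketch

set_option linter.unusedVariables false
set_option linter.dupNamespace false

/-- Tools stub T1: the regularised (core 1) Biot–Savart field of a straight vortex line `σ ↦ P + σ • e`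
(`‖e‖ = 1`) at a point `x`, in closed form: the Rosenhead kernel integrates to the Lorentzian
`2 / (d² + 1)`, `d² = ‖x − P‖² − ⟨x − P, e⟩²` the squared distance from `x` to the line. [folklore] -/
theorem stub_lineBiotSavart : ∀ (P e x : EuclideanSpace ℝ (Fin 3)), ‖e‖ = 1 → MeasureTheory.Integrable (fun σ : ℝ => ((‖x - (P + σ • e)‖ ^ 2 + 1) ^ (3 / 2 : ℝ))⁻¹ • Literature.Analysis.FluidPDE.cross e (x - (P + σ • e))) ∧ ∫ σ : ℝ, ((‖x - (P + σ • e)‖ ^ 2 + 1) ^ (3 / 2 : ℝ))⁻¹ • Literature.Analysis.FluidPDE.cross e (x - (P + σ • e)) = (2 / (‖x - P‖ ^ 2 - (inner ℝ (x - P) e) ^ 2 + 1)) • Literature.Analysis.FluidPDE.cross e (x - P) := by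
  sorry

/-- Tools stub T2: the outer slope-½ law. For a `C²` unit-speed solution of the rotating self-similar binormal
profile equation `Y″ = Y′ × AY`, `A y = ½ y − α e₃ × y`, the drift slip `⟨Y′, AY⟩` has derivative EXACTLY `½`,
hence (integrating from a zero `s₀`) the linear properness bound `|s − s₀| ≤ √(1 + 4α²) ‖Y(s)‖`. [folklore] -/
theorem stub_outerSlopeHalf : ∀ (α : ℝ) (Y : ℝ → EuclideanSpace ℝ (Fin 3)), ContDiff ℝ 2 Y → (∀ s, ‖deriv Y s‖ = 1) → (∀ s, iteratedDeriv 2 Y s = Literature.Analysis.FluidPDE.cross (deriv Y s) ((1 / 2 : ℝ) • Y s - α • Literature.Analysis.FluidPDE.cross (EuclideanSpace.single (2 : Fin 3) (1 : ℝ)) (Y s))) → (∀ s, deriv (fun σ => inner ℝ (deriv Y σ) ((1 / 2 : ℝ) • Y σ - α • Literature.Analysis.FluidPDE.cross (EuclideanSpace.single (2 : Fin 3) (1 : ℝ)) (Y σ))) s = 1 / 2) ∧ (∀ s₀, inner ℝ (deriv Y s₀) ((1 / 2 : ℝ) • Y s₀ - α • Literature.Analysis.FluidPDE.cross (EuclideanSpace.single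 (2 : Fin 3) (1 : ℝ)) (Y s₀)) = 0 → ∀ s, |s - s₀| ≤ Real.sqrt (1 + 4 * α ^ 2) * ‖Y s‖) := by
  sorry

/-- Tools stub T3: the stretching identity. Along a `C²` unit-speed curve `X` on which `u + (½· − α e₃×·)`
is tangent with slip `w` (`u(X τ) + ½ X τ − α e₃ × X τ = w τ • X′ τ`), the slip derivative is
`w′ = ½ + ⟨X′, Du(X) X′⟩`: stretching minus the Leray `½` is the axial strain of `u` (the rotation drops out,
`⟨X′, X″⟩ = 0`). [folklore] -/
theorem stub_stretchingIdentity : ∀ (α : ℝ) (u : EuclideanSpace ℝ (Fin 3) → EuclideanSpace ℝ (Fin 3)) (X : ℝ → EuclideanSpace ℝ (Fin 3)) (w : ℝ → ℝ), Differentiable ℝ u → ContDiff ℝ 2 X → Differentiable ℝ w → (∀ τ, ‖deriv X τ‖ = 1) → (∀ τ, u (X τ) + ((1 / 2 : ℝ) • X τ - α • Literature.Analysis.FluidPDE.cross (EuclideanSpace.single (2 : Fin 3) (1 : ℝ)) (X τ)) = w τ • deriv X τ) → ∀ τ, deriv w τ = 1 / 2 + inner ℝ (deriv X τ) (fderiv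 ℝ u (X τ) (deriv X τ)) := by
  sorry

end Summit.NavierStokesRegularity.NavierStokesRegularity.Cruxes.SkeletonEquilibrium.Sketch
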